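import Literature.NumberTheory.EllipticCurves.BDPAnticyclotomicPAdicLFunction
import Literature.NumberTheory.EllipticCurves.AnticyclotomicRankinSelbergPAdicLFunction
import Literature.NumberTheory.EllipticCurves.IntSeriesIdentityPrinciple
import HarnessLib

/-!
# The two-variable ("toric", `𝛉`-dominant) `p`-adic `L`-function of a weight-two form over an
# imaginary quadratic field in the CM-period normalisation of Castella–Wan, Thm. 2.11: the receptacle
# `R₀⟦T₁⟧⟦T₂⟧` and its values, the interpolation value on the critical cone `Σ⁺`, the
# CHARACTERISING PREDICATE `IsToricTwoVarLFunction`, its agreement with `IsBDPLFunction` on the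
# central ray, and the uniqueness principle (all definitions with bodies; all lemmas proved)

Trunk T-NT-EC (`Literature/NumberTheory/EllipticCurves`). Definition request
`defn-IsToricTwoVarLFunction` (cell `pub/bsd-wall`, pen `bsd-wall-pss3x` g7 after `utd-idea` g43,
typing decision «D1-CONE»; `--for stmt-BirchSwinnertonDyer-20395`; consumers: the lines
`Cruxes/AdditiveSplitIMCInclusionAtThree/Lines/thin_comb*.lean`,
`Cruxes/ToricTransportModThree/Lines/ratwall_thin_comb.lean`, research stub K3 of
`stub_twoVarCombSupply` / `stub_ratCombSupply`). The request: "the rank-2 analogue of the tree's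
`IsBDPLFunction` … for every Hecke character `ψ` of `K` UNRAMIFIED at all finite places, of infinity
type in the 𝛉-DOMINANT CRITICAL CONE for the weight-2 form `f` (a 2-dimensional cone of types,
containing the BDP central-critical ray `(−n, n)`, `n > 0`, of `IsBDPLFunction`), and every `p`-adic
avatar `r` of `ψ` factoring through the `ℤ_p²`-quotient presented by `(κ₁, κ₂)`, the value of `L₂` at
`(T₁, T₂) = (r(γ₁) − 1, r(γ₂) − 1)` (OUTER variable `T₁ ↔ γ₁`, INNER `T₂ ↔ γ₂`) equals
`ι⁻¹(explicit archimedean Γ-factors · E_p(f, ψ) · L(f/K, ψ, 1) / (π-power · Ω_K^{power})) · Ω_p^{power}`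
… READ OFF THE LEVEL exactly as the tree's `bdpInterpolationValue_of_dvd` does … On the central ray
the constant MUST coincide with `bdpInterpolationValue p f 𝔭 ψ n ΩK · Ωp^{4n}`."

## The printed statement (Castella–Wan, Math. Ann. 389 (2023) = arXiv:1607.02019; arXiv numbering,
## store `paper:arxiv-1607.02019`, chunks p0007–p0010)

§2 (p0007): "let `f = ∑ a_n(f) qⁿ ∈ S₂(Γ₀(N_f))` be a newform of level `N_f`, and `K` be an imaginary
quadratic field of discriminant `−D_K < 0` prime to `N_f`. Fix a prime `p ∤ 6 N_f D_K` and a choice of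
complex and `p`-adic embeddings `ℂ ← ℚ̄ → ℂ_p`." §2.1: "We say that `ψ ∈ Ξ_K` has infinity type
`(ℓ₁, ℓ₂) ∈ ℤ²` if `ψ_∞(z) = z^{ℓ₁} z̄^{ℓ₂}` … As a function on fractional ideals, then `ψ` satisfies
`ψ((α)) = α^{−ℓ₁} ᾱ^{−ℓ₂}` for all `α ≡ 1 (mod 𝔠_ψ)`. We say that a Hecke character `ψ` of infinity type
`(ℓ₁, ℓ₂)` is critical for `f` if `s = 1` is a critical value in the sense of Deligne for
`L(f/K, ψ, s) = L(π_f × π_ψ, s + (ℓ₁ + ℓ₂ − 1)/2)` … The set of infinity types of critical characters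
can be written as the disjoint union `Σ = Σ⁻ ⊔ Σ⁺ ⊔ Σ⁺'` with `Σ⁻ = {(0,0)}`,
`Σ⁺ = {(ℓ₁, ℓ₂) : ℓ₁ ≤ −1, ℓ₂ ≥ 1}`, `Σ⁺' = {(ℓ₁, ℓ₂) : ℓ₂ ≤ −1, ℓ₁ ≥ 1}`." Def. 2.1: "The `p`-adic
avatar `ψ̂ : K^×\K̂^× → ℂ_p^×` of `ψ` is defined by `ψ̂(z) = ι_p ι_∞⁻¹(ψ^∞(z)) z_𝔭^{ℓ₁} z_𝔭̄^{ℓ₂}`."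
Thm. 2.7 (p0009, = Bertolini–Darmon–Prasanna / Castella–Hsieh): "`ℒ^BDP_𝔭(f/K) ∈ R₀⟦Γ^ac⟧` … if
`ψ̂` has trivial conductor and infinity type `(−ℓ, ℓ)` with `ℓ ≥ 1`, then
`(ℒ^BDP_𝔭(f/K)(ψ̂)/Ω_p^{2ℓ})² = Γ(ℓ)Γ(ℓ+1) · (1 − p⁻¹ψ(𝔭)α)²(1 − p⁻¹ψ(𝔭)β)² · L(f/K, ψ, 1) /
(π^{2ℓ+1} · Ω_K^{4ℓ})`, where `Ω_p ∈ R₀^×` and `Ω_K ∈ ℂ^×` are CM periods attached to `K`" (`R₀` =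
"the completion of the ring of integers of the maximal unramified extension of `ℚ_p`" = the tree's
`unrIntegers p`; `α, β` the roots of `x² − a_p(f) x + p`). §2.4 (p0010): "`Λ_unr := R₀⟦Γ_K⟧`",
`Γ_K = Gal(K_∞/K)` the Galois group of the `ℤ_p²`-extension.

**Theorem 2.11** (p0010, §2.4 "Another `p`-adic Rankin–Selberg `L`-function"). "Assume that
`p = 𝔭𝔭̄` splits in `K`. There exists a `p`-adic `L`-function `L_𝔭(f/K) ∈ Λ_unr` such that if
`ψ̂ : Γ → ℂ_p^×` has trivial conductor and infinity type `(ℓ₁, ℓ₂) ∈ Σ⁺`, then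
`L_𝔭(f/K)(ψ̂) = Γ(ℓ₂)Γ(ℓ₂+1)/π^{2ℓ₂+1} · 𝓔(f, ψ) · Ω_p^{2(ℓ₂−ℓ₁)}/Ω_K^{2(ℓ₂−ℓ₁)} · L(f/K, ψ, 1)`, where
`𝓔(f, ψ) = (1 − p⁻¹ψ(𝔭)α)(1 − p⁻¹ψ(𝔭)β)(1 − ψ⁻¹(𝔭̄)α⁻¹)(1 − ψ⁻¹(𝔭̄)β⁻¹)`, and `Ω_K` and `Ω_p` are as in
Theorem 2.7. Moreover, `L_𝔭(f/K)` differs from the product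
`L_p(f/K, Σ⁺)(ψ̂) · (h_K/w_K) · ℒ^Katz_{𝔭,ac}(K)(ψ̂^{ρ−1})` by a unit in `Λ^×`, and it is not
identically zero." Proof: "The construction of `L_𝔭(f/K)` is given in [Wan, combined]." Cor. 2.12:
"Assume (Heeg) and that `p = 𝔭𝔭̄` splits in `K` … Then `L_{𝔭,ac}(f/K) = ℒ^BDP_𝔭(f/K)²` up to a unit in
`Λ_ac^×`. Proof. This follows from a direct comparison of their interpolation properties."

## Transcription (tree vocabulary only; every device below is a READING, flagged where a choice is made)

* INFINITY TYPES. Castella–Wan's `(ℓ₁, ℓ₂)` (`ψ_∞(z) = z^{ℓ₁} z̄^{ℓ₂}`, the convention of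
  Castella–Hsieh 2018 §3.3 and Lei–Loeffler–Zerbes 2015 §6.1) is the tree's
  `HeckeCharacter.HasInfinityType (fun _ ↦ −ℓ₁) (fun _ ↦ −ℓ₂)` (module docstrings of
  `BDPAnticyclotomicPAdicLFunction.lean` — Castella's `(−n, n)` is tree `(n, −n)` — and of
  `CastellaGrossiSkinner2025/TwoVariablePAdicLFunctionII.lean`). We parametrise `Σ⁺` by
  `(ℓ₁, ℓ₂) = (−a, b)`, `a ≥ 1`, `b ≥ 1`: tree type `(a, −b)`, i.e.
  `ψ.HasInfinityType (fun _ ↦ (a : ℤ)) (fun _ ↦ -(b : ℤ))`. The central ray of `IsBDPLFunction`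
  (Castella 2018, Thm. 3.1: type `(−n, n)`, `n > 0`, tree `(n, −n)`) is `a = b = n`. (The cone
  `Σ^{(2′)}` of the tree's `CastellaGrossiSkinner2025.IsHidaRankinLFunctionII`, tree types `(−b, c)`,
  is the mirror image `Σ⁺'` under `ψ ↦ ψ^τ`; CGS "reversed the roles of `v` and `v̄`".)
* THE TWO VARIABLES. An adapted pair `(κ₁, κ₂ : ZpExtension K p; γ₁, γ₂)` (meant: a generator pair,
  `ZpExtension.IsTopGeneratorPair κ₁ κ₂ γ₁ γ₂`, whose joint fixed field `K̄^{pairKer κ₁ κ₂}` IS the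
  `ℤ_p²`-extension `K_∞`; `Rubin1991/TwoVariableMainConjecture.lean`); "`ψ̂ : Γ → ℂ_p^×`" = a
  geometric `p`-adic avatar `r` of `ψ` (`IsPAdicAvatarOf ι ψ r`, §3 of
  `BDPAnticyclotomicPAdicLFunction.lean`) factoring through the pair (`FactorsThroughPair κ₁ κ₂ r`);
  the receptacle `Λ_unr = R₀⟦Γ_K⟧ ≅ R₀⟦T₁⟧⟦T₂⟧` (`1 + T_i ↔ γ_i`) is
  `PowerSeries (UnrSeries p) = PowerSeries (PowerSeries (unrIntegers p))` with the OUTER variable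
  `T₁` and the INNER variable `T₂` — the coordinates of the tree's `IwasawaAlgebra₂`,
  `IntSeries.HasValueAt₂`, `IsKatzMeasure₂` and of the requesting lines
  (`Theorems/UniversalToricDescentThinCombDefs.lean`: `T₁ = PowerSeries.X`, `T₂ = C X`); "`L(ψ̂)`" is
  the value at `(T₁, T₂) = (r(γ₁) − 1, r(γ₂) − 1)` (`UnrSeries.HasValueAt₂`, a `HasSum` over `ℕ × ℕ`,
  verbatim the shape of `IntSeries.HasValueAt₂`). ORIENTATION: as in `IsBDPLFunction` /
  `IsKatzMeasure₂` / `IsHidaRankinLFunctionII` (avatar of `ψ`, geometric Frobenii; flag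
  `CGS-241-orientation` of the CGS file applies verbatim — the source does not spell it out).
* "TRIVIAL CONDUCTOR" = `∀ w, ψ.IsUnramifiedAt w`. "`ψ(𝔭)`" = `heckeValueExtZero ψ 𝔭`
  (`= ψ.valueAtUniformizer 𝔭` for unramified `ψ`), "`ψ⁻¹(𝔭̄)`" = `(heckeValueExtZero ψ 𝔭')⁻¹`; the
  primes `𝔭` (meant: the prime above `p` induced by `ι⁻¹`, exactly the parameter `𝔭` of
  `IsBDPLFunction`) and `𝔭' = 𝔭̄` are PARAMETERS.
* THE EULER FACTOR. With `α + β = a_p(f)` (`cuspCoeff f p`) and `αβ = p`: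
  `(1 − p⁻¹xα)(1 − p⁻¹xβ) = 1 − a_p p⁻¹ x + p⁻¹ x²` and `(1 − yα⁻¹)(1 − yβ⁻¹) = 1 − a_p p⁻¹ y + p⁻¹ y²`
  (`α⁻¹ + β⁻¹ = a_p/p`, `(αβ)⁻¹ = p⁻¹`), so `𝓔(f, ψ) = P(ψ(𝔭)) · P(ψ(𝔭̄)⁻¹)` with
  `P(x) = 1 − a_p p⁻¹ x + ε_p x²`, `ε_p = p⁻¹` — the polynomial whose SQUARE at `x = φ(𝔭)` is the
  multiplier `(1 − a_p p⁻¹ φ(𝔭) + ε_p φ(𝔭)²)²` of Castella 2018, Thm. 3.1 (`bdpInterpolationValue`).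
  We write `𝓔` in this root-free form (`bdpLocalFactor`, `toricEulerFactor`; the factorisations are
  the proved lemmas `bdpLocalFactor_eq_mul_of_roots`, `bdpLocalFactor_eq_mul_of_roots'`,
  `toricEulerFactor_eq_castellaWan`) and READ `ε_p` OFF THE LEVEL as the one-variable frame does:
  `ε_p = p⁻¹` if `p ∤ N`, `ε_p = 0` if `p ∣ N` (Castella 2018, Thm. 3.1: "`ε_p = p⁻¹` if `p ∤ N` and
  `ε_p = 0` otherwise"; tree `bdpInterpolationValue_of_dvd`). SCOPE FLAG `CW-211-level`: Castella–Wan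
  print `p ∤ 6 N_f D_K` only; for `p ∣ N` NO two-variable statement is in print — at a multiplicative
  `p` the level-read factor `1 − a_p p⁻¹ x` is Castella's one-variable convention, at an ADDITIVE `p`
  (`a_p = 0`) it is `1`, which is the requesting line's convention («D1-CONE»: "for `p ∣ N` with
  `a_p = 0` (additive) the factor is `1` (no `ε_p`, no `a_p` term)"); the existence of an `L₂` with
  this property at an additive `p` is that line's research stub K3, not a claim of this file.
* `L(f/K, ψ, 1)`: the value at `s = 1` of an ENTIRE CONTINUATION `L` of the Euler product
  `rankinSelbergEulerProductHecke f ψ s` (§1 of `BDPAnticyclotomicPAdicLFunction.lean`; Castella–Wan's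
  `L(f/K, ψ, s)`, Castella–Hsieh's `L(s, π_K ⊗ χ)` shifted to centre `1`), demanded to agree with the
  product on `re s > a + 2`, where it converges absolutely for `ψ` of tree type `(a, −b)`
  (`|ψ(ϖ_w)| = Nw^{(a−b)/2}`): the binder `∀ L, Differentiable ℂ L → (agreement) → …` of
  `IsHidaRankinLFunctionII` / `IsKatzMeasure₂`. The ready-made `rankinSelbergValueHecke f ψ 1` (agreement
  on `re s > 3/2`) is NOT used off the central ray, for the reason recorded in the CGS file (it is junk
  for non-unitary `ψ` with `a > b`); ON the central ray the two readings provably agree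
  (`rankinSelbergValueHecke_eq`), which is how the demanded coincidence with `bdpInterpolationValue` is
  PROVED (`IsToricTwoVarLFunction.hasValueAt₂_centralRay`), granted the anticyclotomic relation
  `ψ(𝔭̄) = ψ(𝔭)⁻¹` (hypothesis `hψ`; automatic for an everywhere unramified `ψ` of type `(−n, n)`,
  which is anticyclotomic — module docstring of `BDPAnticyclotomicPAdicLFunction.lean`, last paragraph —
  but not derived here from the tree's `HeckeCharacter` API).
* PERIODS `Ω_K ∈ ℂ`, `Ω_p ∈ ℂ_p` (meant: `Ω_K ≠ 0`, `Ω_p ∈ R₀^×`, the CM periods of Thm. 2.7 =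
  those of `IsBDPLFunction`) are PARAMETERS; the exponent `2(ℓ₂ − ℓ₁) = 2(a + b)` (`= 4n` on the ray).

## Why a new frame (near-duplicates searched, D-0064 / typer lint rule)

The tree already types three two-variable `𝛉`-dominant objects, all in HIDA'S normalisation (Petersson
norm of the CM form `θ_{ψ_b}`, congruence numbers) and as elements of `Frac Λ_K` or of
`𝒪_{ℂ_p}⟦T₁⟧⟦T₂⟧`: `CastellaGrossiSkinner2025.IsHidaRankinLFunctionII` (CGS Thm. 2.4.1 = LLZ15
Thm. 6.1.3, cone `Σ^{(2′)}`), `IsGreenbergLFunction` (CGS Def. 2.4.3, a PRODUCT with a Katz factor, tied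
to the (cyclotomic, anticyclotomic) pair), `YanZhu2026.IsGreenbergLFunction₂/AnyRoot₂`. Castella–Wan's
`L_𝔭(f/K)` is the CM-PERIOD normalised, `R₀`-INTEGRAL element whose interpolation formula carries no
Petersson norm and no Katz value and restricts ON THE NOSE to Castella's one-variable formula
(Cor. 2.12; here `hasValueAt₂_centralRay`) — the shape the requesting lines need ("so that restriction
to the anticyclotomic line is comparable with `IsBDPLFunction` frames pointwise"), for an ARBITRARY
adapted pair `(κ₁, κ₂)` (the lines use the `𝔭`- and `𝔭̄`-ramified lines). By Thm. 2.11 ("Moreover")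
the two normalisations differ by the anticyclotomic Katz `L`-function and a unit; that comparison is not
restated here.

## Contents

* §1 `UnrSeries.HasValueAt₂ L x y v` (values of `L ∈ R₀⟦T₁⟧⟦T₂⟧`), `unique`, `sub`, the value at the
  trivial character `hasValueAt₂_zero_zero`, the two axis restrictions `hasValueAt₂_zero_left_iff` /
  `hasValueAt₂_zero_right_iff`; the coefficient embedding `unrToInt : R₀ →+* 𝒪_{ℂ_p}`,
  `UnrSeries.toInt₂ : R₀⟦T₁⟧⟦T₂⟧ →+* 𝒪_{ℂ_p}⟦T₁⟧⟦T₂⟧` (injective, value-preserving: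
  `hasValueAt₂_iff_toInt₂`), and the IDENTITY PRINCIPLE transported from the tree's
  `IntSeries.eq_zero_of_infinite_zeros₂` (Gouvêa Cor. 5.6.4): `UnrSeries.eq_zero_of_infinite_zeros₂`,
  `UnrSeries.eq_of_infinite_hasValueAt₂_eq`.
* §2 `bdpLocalFactor p f x = 1 − a_p p⁻¹ x + ε_p x²` (level-read `ε_p`) with `bdpInterpolationValue_eq`
  (the one-variable value IS `Γ(n)Γ(n+1) · bdpLocalFactor² · L / (π^{2n+1} Ω_K^{4n})`) and the root
  factorisations; `toricEulerFactor p f 𝔭 𝔭' ψ = P(ψ(𝔭)) P(ψ(𝔭')⁻¹)` with `toricEulerFactor_eq_castellaWan`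
  (= the printed four-factor `𝓔(f, ψ)` when `p ∤ N`) and `toricEulerFactor_eq_sq` (= `P(ψ(𝔭))²` when
  `ψ(𝔭') = ψ(𝔭)⁻¹`); `toricInterpolationValue p f 𝔭 𝔭' ψ a b ΩK Lval` (the complex part of Thm. 2.11)
  and `toricInterpolationValue_diag_eq_bdpInterpolationValue` (at `a = b = n`, with
  `Lval = rankinSelbergValueHecke f ψ 1` and `ψ(𝔭') = ψ(𝔭)⁻¹`, it IS `bdpInterpolationValue p f 𝔭 ψ n ΩK`).
* §3 **`IsToricTwoVarLFunction ι 𝔭 𝔭' κ₁ κ₂ γ₁ γ₂ f ΩK Ωp L₂`** and its API: `hasValueAt₂`,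
  `eq_of_hasValueAt₂`, `hasValueAt₂_of_hasValueAt₂` (two frames prescribe the same values),
  **`hasValueAt₂_centralRay`** (on the ray the prescribed value is
  `ι⁻¹(bdpInterpolationValue p f 𝔭 ψ n ΩK) · Ωp^{4n}`, the right-hand side of `IsBDPLFunction`),
  `exists_hasValueAt₂_and_bdp` (pointwise agreement with any `IsBDPLFunction ι 𝔭 κ γ f ΩK Ωp L₁`),
  and the UNIQUENESS THEOREM **`eq_of_infinite`**: two `L₂` satisfying the predicate with the same
  parameters are EQUAL as soon as the interpolation points contain a product `D₁ × D₂` of two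
  infinite subsets of a closed disc `‖·‖ ≤ ‖ϖ‖ < 1` — the "iterated one-variable density" the request
  names, in the form the identity principle needs. (For the `𝔭`- and `𝔭̄`-ramified pair of the requesting
  lines the points `(ψ̂(γ₁) − 1, ψ̂(γ₂) − 1)` of unramified `ψ` of type `(−a, b)` depend on `a` resp.
  `b` alone and accumulate at `0`, so such grids exist granted a supply of interpolation characters;
  that supply — existence of Hecke characters with prescribed type and avatar — is NOT constructed
  here, and the general Zariski-density statement for arbitrary pairs is not formalised.)

HONEST SCOPE: a characterising PREDICATE (frame), its special values and proved API; no construction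
of `L_𝔭(f/K)`, NO existence claim and NO named fact (Castella–Wan's existence statement, Thm. 2.11
for `p ∤ 6 N_f D_K` split, is one `def` away but has no consumer yet; the requesting line's existence
at an additive `p` is its research stub K3); nothing about main conjectures; BSD is proved for no curve.
No `sorry`, no `instance`, no `notation`. Deviation from the requested signature: the generator-pair
hypothesis `[Fact (ZpExtension.IsTopGeneratorPair κ₁ κ₂ γ₁ γ₂)]` is not a binder of the predicate (it
is not used by it, exactly as `IsBDPLFunction` does not bind `IsTopGenerator`); consumers add it.

## References

* [CastellaWan2023] F. Castella, X. Wan, *Perrin-Riou's main conjecture for elliptic curves at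
  supersingular primes*, Math. Ann. 389 (2023/24) 2595–2636 = arXiv:1607.02019: §2–§2.1 (conventions,
  `Σ⁺`, Def. 2.1), Thm. 2.7, §2.4 Thm. 2.11, Cor. 2.12 (arXiv numbering; store
  `paper:arxiv-1607.02019` p0007–p0010; the journal numbers theorems differently).
* [Castella2018] F. Castella, Camb. J. Math. 6 (2018), Thm. 3.1 (the one-variable formula, `ε_p`).
* [CastellaHsieh2018] F. Castella, M.-L. Hsieh, Math. Ann. 370 (2018), §3.3 (infinity types, avatars),
  §2.5 (the CM periods `Ω_K`, `Ω_p`).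
* [Gouvea1993PadicNumbers] F. Q. Gouvêa, *p-adic Numbers*, §5.6 Cor. 5.6.3–5.6.4 (identity principle;
  tree `IntSeriesIdentityPrinciple.lean`).
* [deShalit1987] E. de Shalit, *Iwasawa theory of elliptic curves with complex multiplication*, II.4.17
  (54) (two-variable power series of a measure on a `ℤ_p²`-extension; tree `IntSeries.HasValueAt₂`).
-/

noncomputable section

open scoped MatrixGroups ModularForm Topology
open Filter CongruenceSubgroup NumberField IsDedekindDomain Field Polynomial
open Literature.NumberTheory.GaloisRepresentations
open Literature.NumberTheory.EllipticCurves.ModularForms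

universe u

namespace Literature.NumberTheory.EllipticCurves

/-! ### §1. The receptacle `Λ_unr = R₀⟦T₁⟧⟦T₂⟧`, its values, and the identity principle -/

section Receptacle

variable {p : ℕ} [Fact p.Prime]

/-- **The value of `L ∈ R₀⟦T₁⟧⟦T₂⟧ = Λ_unr` at a point `(x, y)` of the open unit polydisc of `ℂ_p²`**:
`∑_{(i,j)} [T₁^i T₂^j]L · x^i y^j = v` as a `HasSum` over `ℕ × ℕ`. `L : PowerSeries (UnrSeries p)` is
read with the OUTER variable `T₁` (`PowerSeries.coeff i L ∈ R₀⟦T₂⟧`) and the inner `T₂`; the value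
`L(ψ̂)` at a character `ψ̂` of `Γ_K ≅ ℤ_p γ₁ ⊕ ℤ_p γ₂` is the value at `(ψ̂(γ₁) − 1, ψ̂(γ₂) − 1)`
(`1 + T_i ↔ γ_i`). Verbatim the tree's `IntSeries.HasValueAt₂` with coefficients in
`R₀ = unrIntegers p ⊆ 𝒪_{ℂ_p}` (Castella–Wan: "`Λ_unr := R₀⟦Γ_K⟧`", "`L_𝔭(f/K)(ψ̂)`").
[cite: CastellaWan2023, §2.4 (Λ_unr, arXiv:1607.02019 store p0010)] [cite: deShalit1987, II.4.17 (54) (store chunk 78)] -/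
def UnrSeries.HasValueAt₂ (L : PowerSeries (UnrSeries p)) (x y v : ℂ_[p]) : Prop :=
  HasSum (fun k : ℕ × ℕ ↦
    ((PowerSeries.coeff k.2 (PowerSeries.coeff k.1 L) : unrIntegers p) : ℂ_[p]) * x ^ k.1 * y ^ k.2) v

/-- The value at a point is unique (a `HasSum` limit in the Hausdorff space `ℂ_p`).
[cite: CastellaWan2023, §2.4 (arXiv:1607.02019 store p0010)] -/
theorem UnrSeries.HasValueAt₂.unique {L : PowerSeries (UnrSeries p)} {x y v v' : ℂ_[p]}
    (h : UnrSeries.HasValueAt₂ L x y v) (h' : UnrSeries.HasValueAt₂ L x y v') : v = v' :=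
  HasSum.unique h h'

/-- Values are additive: if `L` has value `v` and `L'` has value `v'` at `(x, y)` then `L − L'` has the
value `v − v'` there (termwise difference of two convergent double sums).
[cite: Gouvea1993PadicNumbers, §5.6 Cor. 5.6.4 (proof)] -/
theorem UnrSeries.HasValueAt₂.sub {L L' : PowerSeries (UnrSeries p)} {x y v v' : ℂ_[p]}
    (h : UnrSeries.HasValueAt₂ L x y v) (h' : UnrSeries.HasValueAt₂ L' x y v') :
    UnrSeries.HasValueAt₂ (L - L') x y (v - v') := by
  unfold UnrSeries.HasValueAt₂ at *
  refine (HasSum.sub h h').congr_fun fun k ↦ ?_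
  rw [map_sub, map_sub]
  push_cast
  ring

/-- **The value at the trivial character is the double constant term**: `L(0, 0) = [T₁⁰T₂⁰]L`
(only the term `(i, j) = (0, 0)` survives). The two-variable twin of `UnrSeries.hasValueAt_zero`.
[cite: CastellaWan2023, §2.4 (arXiv:1607.02019 store p0010)] -/
theorem UnrSeries.hasValueAt₂_zero_zero (L : PowerSeries (UnrSeries p)) :
    UnrSeries.HasValueAt₂ L 0 0
      ((PowerSeries.constantCoeff (PowerSeries.constantCoeff L) : unrIntegers p) : ℂ_[p]) := by
  unfold UnrSeries.HasValueAt₂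
  have h := hasSum_single (f := fun k : ℕ × ℕ ↦
    ((PowerSeries.coeff k.2 (PowerSeries.coeff k.1 L) : unrIntegers p) : ℂ_[p]) *
      (0 : ℂ_[p]) ^ k.1 * (0 : ℂ_[p]) ^ k.2) ((0 : ℕ), (0 : ℕ)) (by
      rintro ⟨i, j⟩ hij
      rcases i with _ | i
      · rcases j with _ | j
        · exact absurd rfl hij
        · simp
      · simp)
  simpa [PowerSeries.coeff_zero_eq_constantCoeff_apply] using h

/-- **Restriction to the inner line `T₁ = 0`** (characters with `ψ̂(γ₁) = 1`, e.g. those factoring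
through `κ₂` when `κ₂(γ₁) = 0`): the value of `L` at `(0, y)` is the value at `y` of its constant
coefficient in the OUTER variable, `L(0, ·) = PowerSeries.constantCoeff L ∈ R₀⟦T₂⟧`
(`UnrSeries.HasValueAt`). Verbatim `IntSeries.hasValueAt₂_zero_left_iff`.
[cite: deShalit1987, II.4.17 (52)–(54) (store chunk 77–78)] -/
theorem UnrSeries.hasValueAt₂_zero_left_iff (L : PowerSeries (UnrSeries p)) (y v : ℂ_[p]) :
    UnrSeries.HasValueAt₂ L 0 y v ↔ (PowerSeries.constantCoeff L).HasValueAt y v := by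
  unfold UnrSeries.HasValueAt₂ UnrSeries.HasValueAt
  have hinj : Function.Injective (fun j : ℕ ↦ ((0 : ℕ), j)) := fun a b h ↦ by
    simpa using congrArg Prod.snd h
  rw [← hinj.hasSum_iff]
  · refine Iff.of_eq (congrArg (fun f ↦ HasSum f v) ?_)
    funext j
    simp [Function.comp, PowerSeries.coeff_zero_eq_constantCoeff_apply]
  · rintro ⟨i, j⟩ hij
    rcases i with _ | i
    · exact absurd ⟨j, rfl⟩ hij
    · simp

/-- **Restriction to the outer line `T₂ = 0`** (characters with `ψ̂(γ₂) = 1`): the value of `L` at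
`(x, 0)` is the value at `x` of the series of inner constant terms
`PowerSeries.map PowerSeries.constantCoeff L ∈ R₀⟦T₁⟧`.
[cite: deShalit1987, II.4.17 (52)–(54) (store chunk 77–78)] -/
theorem UnrSeries.hasValueAt₂_zero_right_iff (L : PowerSeries (UnrSeries p)) (x v : ℂ_[p]) :
    UnrSeries.HasValueAt₂ L x 0 v ↔
      UnrSeries.HasValueAt (PowerSeries.map (PowerSeries.constantCoeff (R := unrIntegers p)) L)
        x v := by
  unfold UnrSeries.HasValueAt₂ UnrSeries.HasValueAt
  have hinj : Function.Injective (fun i : ℕ ↦ (i, (0 : ℕ))) := fun a b h ↦ by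
    simpa using congrArg Prod.fst h
  rw [← hinj.hasSum_iff]
  · refine Iff.of_eq (congrArg (fun f ↦ HasSum f v) ?_)
    funext i
    simp [Function.comp, PowerSeries.coeff_zero_eq_constantCoeff_apply, PowerSeries.coeff_map]
  · rintro ⟨i, j⟩ hij
    rcases j with _ | j
    · exact absurd ⟨i, rfl⟩ hij
    · simp

/-- **The coefficient embedding `R₀ ↪ 𝒪_{ℂ_p}`** (`unrIntegers_le_padicComplexInt`: roots of unity of
order prime to `p` are integral and `𝒪_{ℂ_p}` is closed), as a ring homomorphism into the tree's
`PadicComplexInt p` — so that an element of `Λ_unr = R₀⟦T₁⟧⟦T₂⟧` can be read in the receptacle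
`𝒪_{ℂ_p}⟦T₁⟧⟦T₂⟧` of `IntSeries.HasValueAt₂` / `IsKatzMeasure₂` / `IsHidaRankinLFunctionII`.
[cite: Castella2018, §3 (R₀ ⊂ ℂ_p, arXiv:1704.06608 p. 9)] -/
def unrToInt : unrIntegers p →+* PadicComplexInt p where
  toFun x := ⟨(x : ℂ_[p]),
    (ValuationSubring.mem_toSubring _ _).mp (unrIntegers_le_padicComplexInt x.2)⟩
  map_one' := rfl
  map_mul' _ _ := rfl
  map_zero' := rfl
  map_add' _ _ := rfl

/-- `unrToInt` is the identity on underlying elements of `ℂ_p`. [cite: Castella2018, §3 (arXiv:1704.06608 p. 9)] -/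
@[simp] theorem coe_unrToInt (x : unrIntegers p) :
    ((unrToInt x : PadicComplexInt p) : ℂ_[p]) = x :=
  rfl

/-- `unrToInt` is injective (it is an inclusion of subrings of `ℂ_p`). [cite: Castella2018, §3 (arXiv:1704.06608 p. 9)] -/
theorem unrToInt_injective : Function.Injective (unrToInt (p := p)) := fun _ _ h ↦
  Subtype.ext (congrArg (fun c : PadicComplexInt p ↦ (c : ℂ_[p])) h)

/-- **`Λ_unr = R₀⟦T₁⟧⟦T₂⟧ ↪ 𝒪_{ℂ_p}⟦T₁⟧⟦T₂⟧`**, coefficientwise `unrToInt` (a ring homomorphism;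
`PowerSeries.map` twice). [cite: CastellaWan2023, §2.4 (Λ_unr ⊂ measures with values in ℂ_p, arXiv:1607.02019 store p0010)] -/
def UnrSeries.toInt₂ :
    PowerSeries (UnrSeries p) →+* PowerSeries (PowerSeries (PadicComplexInt p)) :=
  PowerSeries.map (PowerSeries.map (unrToInt (p := p)))

/-- The coefficients of `toInt₂ L` are those of `L`, read in `ℂ_p`.
[cite: CastellaWan2023, §2.4 (arXiv:1607.02019 store p0010)] -/
theorem UnrSeries.coe_coeff_coeff_toInt₂ (L : PowerSeries (UnrSeries p)) (i j : ℕ) :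
    ((PowerSeries.coeff j (PowerSeries.coeff i (UnrSeries.toInt₂ L)) : PadicComplexInt p) : ℂ_[p]) =
      ((PowerSeries.coeff j (PowerSeries.coeff i L) : unrIntegers p) : ℂ_[p]) := by
  simp [UnrSeries.toInt₂, PowerSeries.coeff_map]

/-- `toInt₂` is injective. [cite: CastellaWan2023, §2.4 (arXiv:1607.02019 store p0010)] -/
theorem UnrSeries.toInt₂_injective : Function.Injective (UnrSeries.toInt₂ (p := p)) := by
  intro L L' h
  ext i j
  have hij := congrArg (fun G ↦ ((PowerSeries.coeff j (PowerSeries.coeff i G) : PadicComplexInt p) :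
    ℂ_[p])) h
  simp only [UnrSeries.coe_coeff_coeff_toInt₂] at hij
  exact_mod_cast hij

/-- **Values are preserved by the coefficient embedding**: `L` has the value `v` at `(x, y)` iff
`toInt₂ L` has (in the currency `IntSeries.HasValueAt₂`). The bridge to the two-variable frames and to
the identity principle of the tree. [cite: CastellaWan2023, §2.4 (arXiv:1607.02019 store p0010)]
[cite: deShalit1987, II.4.17 (54) (store chunk 78)] -/
theorem UnrSeries.hasValueAt₂_iff_toInt₂ (L : PowerSeries (UnrSeries p)) (x y v : ℂ_[p]) :
    UnrSeries.HasValueAt₂ L x y v ↔ IntSeries.HasValueAt₂ (UnrSeries.toInt₂ L) x y v := by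
  unfold UnrSeries.HasValueAt₂ IntSeries.HasValueAt₂
  simp_rw [UnrSeries.coe_coeff_coeff_toInt₂]

/-- **The identity principle for `R₀⟦T₁⟧⟦T₂⟧`, zeros form** (transported from
`IntSeries.eq_zero_of_infinite_zeros₂`): if `L(x, y) = 0` for all `x ∈ D₁`, `y ∈ D₂`, where `D₁, D₂`
are INFINITE subsets of a closed disc of radius `‖ϖ‖`, `0 < ‖ϖ‖ < 1`, then `L = 0`.
[cite: Gouvea1993PadicNumbers, §5.6 Cor. 5.6.3 and Cor. 5.6.4] [cite: deShalit1987, II.6.4 proof (p. 85)] -/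
theorem UnrSeries.eq_zero_of_infinite_zeros₂ {L : PowerSeries (UnrSeries p)} {ϖ : ℂ_[p]}
    (hϖ0 : ϖ ≠ 0) (hϖ : ‖ϖ‖ < 1) {D₁ D₂ : Set ℂ_[p]}
    (hD₁ : D₁.Infinite) (hD₁ϖ : ∀ x ∈ D₁, ‖x‖ ≤ ‖ϖ‖)
    (hD₂ : D₂.Infinite) (hD₂ϖ : ∀ y ∈ D₂, ‖y‖ ≤ ‖ϖ‖)
    (h : ∀ x ∈ D₁, ∀ y ∈ D₂, UnrSeries.HasValueAt₂ L x y 0) : L = 0 := by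
  apply UnrSeries.toInt₂_injective
  rw [map_zero]
  set D₁' : Set (PadicComplexInt p) := {c | (c : ℂ_[p]) ∈ D₁} with hD₁'
  have hD₁'inf : D₁'.Infinite := by
    intro hfin
    apply hD₁
    refine (hfin.image (fun c : PadicComplexInt p ↦ (c : ℂ_[p]))).subset fun x hx ↦ ?_
    have hx1 : x ∈ PadicComplexInt p :=
      mem_padicComplexInt_iff.mpr ((hD₁ϖ x hx).trans hϖ.le)
    exact ⟨⟨x, hx1⟩, hx, rfl⟩
  refine IntSeries.eq_zero_of_infinite_zeros₂ hϖ0 hϖ hD₁'inf (fun c hc ↦ hD₁ϖ _ hc) hD₂ hD₂ϖ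
    fun c hc y hy ↦ ?_
  exact (UnrSeries.hasValueAt₂_iff_toInt₂ L _ _ _).mp (h _ hc y hy)

/-- **The identity principle for `R₀⟦T₁⟧⟦T₂⟧`, agreement form**: two series with a common value at
every point of a product `D₁ × D₂` of infinite subsets of a closed disc `‖·‖ ≤ ‖ϖ‖`, `0 < ‖ϖ‖ < 1`,
are equal. [cite: Gouvea1993PadicNumbers, §5.6 Cor. 5.6.4] [cite: deShalit1987, II.6.4 proof (p. 85)] -/
theorem UnrSeries.eq_of_infinite_hasValueAt₂_eq {L L' : PowerSeries (UnrSeries p)} {ϖ : ℂ_[p]}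
    (hϖ0 : ϖ ≠ 0) (hϖ : ‖ϖ‖ < 1) {D₁ D₂ : Set ℂ_[p]}
    (hD₁ : D₁.Infinite) (hD₁ϖ : ∀ x ∈ D₁, ‖x‖ ≤ ‖ϖ‖)
    (hD₂ : D₂.Infinite) (hD₂ϖ : ∀ y ∈ D₂, ‖y‖ ≤ ‖ϖ‖)
    (h : ∀ x ∈ D₁, ∀ y ∈ D₂, ∃ v : ℂ_[p],
      UnrSeries.HasValueAt₂ L x y v ∧ UnrSeries.HasValueAt₂ L' x y v) : L = L' := by
  refine sub_eq_zero.mp (UnrSeries.eq_zero_of_infinite_zeros₂ hϖ0 hϖ hD₁ hD₁ϖ hD₂ hD₂ϖ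
    fun x hx y hy ↦ ?_)
  obtain ⟨v, hv, hv'⟩ := h x hx y hy
  simpa using hv.sub hv'

end Receptacle

/-! ### §2. The interpolation value of Castella–Wan, Thm. 2.11 (complex part) -/

section Interpolation

variable {K : Type u} [Field K] [NumberField K] {N : ℕ}

/-- **`P(x) = 1 − a_p p⁻¹ x + ε_p x²`**, the local factor of Castella 2018, Thm. 3.1 BEFORE squaring
(`(1 − a_p p⁻¹ φ(𝔭) + ε_p φ²(𝔭))²`, "`ε_p = p⁻¹` if `p ∤ N` and `ε_p = 0` otherwise"), with `ε_p`
READ OFF THE LEVEL `N` of `f` exactly as in `bdpInterpolationValue` (`bdpInterpolationValue_eq`).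
For `p ∤ N` and `α + β = a_p`, `αβ = p` it is `(1 − p⁻¹xα)(1 − p⁻¹xβ) = (1 − x·α⁻¹)(1 − x·β⁻¹)|_{x ↦ x}`
(`bdpLocalFactor_eq_mul_of_roots`, `…_roots'`): BOTH halves of Castella–Wan's `𝓔(f, ψ)`.
[cite: Castella2018, Thm. 3.1] [cite: CastellaWan2023, §2.4 Thm. 2.11 (𝓔(f,ψ), arXiv:1607.02019 store p0010)] -/
def bdpLocalFactor (p : ℕ) (f : CuspForm (Gamma0 N) 2) (x : ℂ) : ℂ :=
  let εp : ℂ := if p ∣ N then 0 else ((p : ℂ))⁻¹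
  1 - cuspCoeff f p * ((p : ℂ))⁻¹ * x + εp * x ^ 2

/-- At a prime of the level, `ε_p = 0`: `P(x) = 1 − a_p p⁻¹ x` (Castella 2018, proof of Thm. 3.1; at an
additive `p`, `a_p = 0`, this is `1`). [cite: Castella2018, Thm. 3.1 (proof, "1 − a_p p⁻¹ φ(𝔭̄) for unramified φ")] -/
theorem bdpLocalFactor_of_dvd {p : ℕ} (hpN : p ∣ N) (f : CuspForm (Gamma0 N) 2) (x : ℂ) :
    bdpLocalFactor p f x = 1 - cuspCoeff f p * ((p : ℂ))⁻¹ * x := by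
  simp [bdpLocalFactor, hpN]

/-- Away from the level, `ε_p = p⁻¹`: `P(x) = 1 − a_p p⁻¹ x + p⁻¹ x²`. [cite: Castella2018, Thm. 3.1] -/
theorem bdpLocalFactor_of_not_dvd {p : ℕ} (hpN : ¬ p ∣ N) (f : CuspForm (Gamma0 N) 2) (x : ℂ) :
    bdpLocalFactor p f x = 1 - cuspCoeff f p * ((p : ℂ))⁻¹ * x + ((p : ℂ))⁻¹ * x ^ 2 := by
  simp [bdpLocalFactor, hpN]

/-- **`P(x) = (1 − p⁻¹xα)(1 − p⁻¹xβ)`** for the roots `α, β` of `x² − a_p x + p` (`p ∤ N`): the first half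
`(1 − p⁻¹ψ(𝔭)α)(1 − p⁻¹ψ(𝔭)β)` of Castella–Wan's `𝓔(f, ψ)` is `P(ψ(𝔭))`.
[cite: CastellaWan2023, §2.4 Thm. 2.11 (𝓔(f,ψ)) and Thm. 2.7 (arXiv:1607.02019 store p0009–p0010)] -/
theorem bdpLocalFactor_eq_mul_of_roots {p : ℕ} (hpN : ¬ p ∣ N) (hp : (p : ℂ) ≠ 0)
    (f : CuspForm (Gamma0 N) 2) {α β : ℂ} (hsum : α + β = cuspCoeff f p) (hprod : α * β = p)
    (x : ℂ) :
    bdpLocalFactor p f x = (1 - ((p : ℂ))⁻¹ * x * α) * (1 - ((p : ℂ))⁻¹ * x * β) := by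
  rw [bdpLocalFactor_of_not_dvd hpN, ← hsum]
  have h2 : ((p : ℂ))⁻¹ * x ^ 2 = ((p : ℂ))⁻¹ * ((p : ℂ))⁻¹ * x ^ 2 * (α * β) := by
    rw [hprod]; field_simp
  rw [h2]; ring

/-- **`P(y) = (1 − yα⁻¹)(1 − yβ⁻¹)`** for the roots `α, β` of `x² − a_p x + p` (`p ∤ N`;
`α⁻¹ + β⁻¹ = a_p/p`, `(αβ)⁻¹ = p⁻¹`): the second half `(1 − ψ⁻¹(𝔭̄)α⁻¹)(1 − ψ⁻¹(𝔭̄)β⁻¹)` of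
Castella–Wan's `𝓔(f, ψ)` is `P(ψ(𝔭̄)⁻¹)`. [cite: CastellaWan2023, §2.4 Thm. 2.11 (𝓔(f,ψ), arXiv:1607.02019 store p0010)] -/
theorem bdpLocalFactor_eq_mul_of_roots' {p : ℕ} (hpN : ¬ p ∣ N) (hp : (p : ℂ) ≠ 0)
    (f : CuspForm (Gamma0 N) 2) {α β : ℂ} (hsum : α + β = cuspCoeff f p) (hprod : α * β = p)
    (y : ℂ) :
    bdpLocalFactor p f y = (1 - y * α⁻¹) * (1 - y * β⁻¹) := by
  have hαβ : α * β ≠ 0 := by rw [hprod]; exact hp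
  have hα : α ≠ 0 := left_ne_zero_of_mul hαβ
  have hβ : β ≠ 0 := right_ne_zero_of_mul hαβ
  rw [bdpLocalFactor_of_not_dvd hpN, ← hsum]
  have hαi : α⁻¹ = ((p : ℂ))⁻¹ * β := by
    rw [← hprod]; field_simp
  have hβi : β⁻¹ = ((p : ℂ))⁻¹ * α := by
    rw [← hprod]; field_simp
  rw [hαi, hβi]
  have h2 : ((p : ℂ))⁻¹ * y ^ 2 = ((p : ℂ))⁻¹ * ((p : ℂ))⁻¹ * y ^ 2 * (α * β) := by
    rw [hprod]; field_simp
  rw [h2]; ring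

/-- The one-variable interpolation value of the tree IS `Γ(n)Γ(n+1) · P(φ(𝔭))² · L(f/K, φ, 1) /
(π^{2n+1} Ω_K^{4n})` with `P = bdpLocalFactor` (definitional bookkeeping, so that the two frames share
one Euler polynomial). [cite: Castella2018, Thm. 3.1] -/
theorem bdpInterpolationValue_eq (p : ℕ) (f : CuspForm (Gamma0 N) 2) (𝔭 : HeightOneSpectrum (𝓞 K))
    (φ : HeckeCharacter K) (n : ℕ) (ΩK : ℂ) :
    bdpInterpolationValue p f 𝔭 φ n ΩK =
      Complex.Gamma n * Complex.Gamma (n + 1) * bdpLocalFactor p f (heckeValueExtZero φ 𝔭) ^ 2 *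
        rankinSelbergValueHecke f φ 1 / ((Real.pi : ℂ) ^ (2 * n + 1) * ΩK ^ (4 * n)) :=
  rfl

/-- **`𝓔(f, ψ) = P(ψ(𝔭)) · P(ψ(𝔭̄)⁻¹)`**, Castella–Wan's `p`-Euler factor
`(1 − p⁻¹ψ(𝔭)α)(1 − p⁻¹ψ(𝔭)β)(1 − ψ⁻¹(𝔭̄)α⁻¹)(1 − ψ⁻¹(𝔭̄)β⁻¹)` in root-free form
(`toricEulerFactor_eq_castellaWan`), with `ψ(𝔭) = heckeValueExtZero ψ 𝔭`,
`ψ⁻¹(𝔭̄) = (heckeValueExtZero ψ 𝔭')⁻¹` (`𝔭' = 𝔭̄`; for `ψ` ramified at `𝔭'` the junk value `0⁻¹ = 0`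
is read — outside the typed range) and `ε_p` read off the level (scope flag `CW-211-level`, module
docstring). [cite: CastellaWan2023, §2.4 Thm. 2.11 (𝓔(f,ψ), arXiv:1607.02019 store p0010)] -/
def toricEulerFactor (p : ℕ) (f : CuspForm (Gamma0 N) 2) (𝔭 𝔭' : HeightOneSpectrum (𝓞 K))
    (ψ : HeckeCharacter K) : ℂ :=
  bdpLocalFactor p f (heckeValueExtZero ψ 𝔭) * bdpLocalFactor p f (heckeValueExtZero ψ 𝔭')⁻¹

/-- **Faithfulness of the root-free form**: for `p ∤ N` and `α, β` the roots of `x² − a_p(f) x + p`,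
`toricEulerFactor` IS the printed `𝓔(f, ψ) = (1 − p⁻¹ψ(𝔭)α)(1 − p⁻¹ψ(𝔭)β)(1 − ψ⁻¹(𝔭̄)α⁻¹)(1 − ψ⁻¹(𝔭̄)β⁻¹)`.
[cite: CastellaWan2023, §2.4 Thm. 2.11 (𝓔(f,ψ), arXiv:1607.02019 store p0010)] -/
theorem toricEulerFactor_eq_castellaWan {p : ℕ} (hpN : ¬ p ∣ N) (hp : (p : ℂ) ≠ 0)
    (f : CuspForm (Gamma0 N) 2) {α β : ℂ} (hsum : α + β = cuspCoeff f p) (hprod : α * β = p)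
    (𝔭 𝔭' : HeightOneSpectrum (𝓞 K)) (ψ : HeckeCharacter K) :
    toricEulerFactor p f 𝔭 𝔭' ψ =
      (1 - ((p : ℂ))⁻¹ * heckeValueExtZero ψ 𝔭 * α) * (1 - ((p : ℂ))⁻¹ * heckeValueExtZero ψ 𝔭 * β) *
        ((1 - (heckeValueExtZero ψ 𝔭')⁻¹ * α⁻¹) * (1 - (heckeValueExtZero ψ 𝔭')⁻¹ * β⁻¹)) := by
  rw [toricEulerFactor, bdpLocalFactor_eq_mul_of_roots hpN hp f hsum hprod,
    bdpLocalFactor_eq_mul_of_roots' hpN hp f hsum hprod]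

/-- **On the anticyclotomic line `𝓔(f, ψ) = P(ψ(𝔭))²`**: if `ψ(𝔭̄) = ψ(𝔭)⁻¹` (which holds for every
anticyclotomic `ψ`, `ψ^ρ = ψ⁻¹` — in particular for every everywhere-unramified `ψ` of type `(−n, n)`),
then Castella–Wan's factor is the multiplier of Castella 2018, Thm. 3.1 / of Thm. 2.7 (Cor. 2.12: "a
direct comparison of their interpolation properties"). [cite: CastellaWan2023, Cor. 2.12 with Thm. 2.7 and Thm. 2.11 (arXiv:1607.02019 store p0009–p0010)] -/
theorem toricEulerFactor_eq_sq {p : ℕ} (f : CuspForm (Gamma0 N) 2) {𝔭 𝔭' : HeightOneSpectrum (𝓞 K)}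
    {ψ : HeckeCharacter K} (hψ : heckeValueExtZero ψ 𝔭' = (heckeValueExtZero ψ 𝔭)⁻¹) :
    toricEulerFactor p f 𝔭 𝔭' ψ = bdpLocalFactor p f (heckeValueExtZero ψ 𝔭) ^ 2 := by
  rw [toricEulerFactor, hψ, inv_inv, sq]

/-- **The complex part of Castella–Wan's interpolation value** (Thm. 2.11) at an everywhere unramified
Hecke character `ψ` of infinity type `(ℓ₁, ℓ₂) = (−a, b) ∈ Σ⁺` (`a, b ≥ 1`; tree type `(a, −b)`):
`Γ(b)Γ(b+1)/π^{2b+1} · 𝓔(f, ψ) · L(f/K, ψ, 1) / Ω_K^{2(a+b)}` (`2(ℓ₂ − ℓ₁) = 2(a+b)`), given the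
value `Lval = L(f/K, ψ, 1)` (the caller supplies the value of an entire continuation, see the predicate)
and the complex CM period `Ω_K`; the printed value is this times `Ω_p^{2(a+b)}`, transported by `ι⁻¹`.
[cite: CastellaWan2023, §2.4 Thm. 2.11 (arXiv:1607.02019 store p0010)] -/
def toricInterpolationValue (p : ℕ) (f : CuspForm (Gamma0 N) 2) (𝔭 𝔭' : HeightOneSpectrum (𝓞 K))
    (ψ : HeckeCharacter K) (a b : ℕ) (ΩK Lval : ℂ) : ℂ :=
  Complex.Gamma b * Complex.Gamma (b + 1) * toricEulerFactor p f 𝔭 𝔭' ψ * Lval /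
    ((Real.pi : ℂ) ^ (2 * b + 1) * ΩK ^ (2 * (a + b)))

/-- **The demanded coincidence on the central ray** («D1-CONE»: "On the central ray `(−n, n)` the
constant MUST coincide with `bdpInterpolationValue p f 𝔭 ψ n ΩK`"): at `a = b = n`, with
`Lval = rankinSelbergValueHecke f ψ 1` and the anticyclotomic relation `ψ(𝔭̄) = ψ(𝔭)⁻¹`,
`toricInterpolationValue` IS the tree's one-variable `bdpInterpolationValue` —
`Γ(n)Γ(n+1) · P(ψ(𝔭))² · L(f/K, ψ, 1)/(π^{2n+1} Ω_K^{4n})` (Castella–Wan Cor. 2.12 pointwise: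
`L_{𝔭,ac}(f/K)` and `ℒ^BDP_𝔭(f/K)²` interpolate the same values).
[cite: CastellaWan2023, Cor. 2.12 with Thm. 2.7 and Thm. 2.11 (arXiv:1607.02019 store p0009–p0010)] [cite: Castella2018, Thm. 3.1] -/
theorem toricInterpolationValue_diag_eq_bdpInterpolationValue (p : ℕ) (f : CuspForm (Gamma0 N) 2)
    {𝔭 𝔭' : HeightOneSpectrum (𝓞 K)} {ψ : HeckeCharacter K}
    (hψ : heckeValueExtZero ψ 𝔭' = (heckeValueExtZero ψ 𝔭)⁻¹) (n : ℕ) (ΩK : ℂ) :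
    toricInterpolationValue p f 𝔭 𝔭' ψ n n ΩK (rankinSelbergValueHecke f ψ 1) =
      bdpInterpolationValue p f 𝔭 ψ n ΩK := by
  rw [toricInterpolationValue, toricEulerFactor_eq_sq f hψ]
  simp only [bdpLocalFactor, bdpInterpolationValue]
  ring_nf

end Interpolation

/-! ### §3. The characterising predicate `IsToricTwoVarLFunction`, its agreement with
`IsBDPLFunction` on the central ray, and uniqueness -/

section Frame

variable {K : Type u} [Field K] [NumberField K] {N : ℕ} {p : ℕ} [Fact p.Prime]

/-- **The interpolation property of the two-variable `𝛉`-dominant ("toric") `p`-adic `L`-function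
`L_𝔭(f/K) ∈ Λ_unr = R₀⟦Γ_K⟧` in the CM-period normalisation of Castella–Wan, Thm. 2.11**, as a
CHARACTERISING PREDICATE on `L₂ ∈ R₀⟦T₁⟧⟦T₂⟧` (`1 + T₁ ↔ γ₁` outer, `1 + T₂ ↔ γ₂` inner, for the
pair of `ℤ_p`-extensions `(κ₁, κ₂)` presenting `Γ_K ≅ ℤ_p²`): for every idelic Hecke character `ψ` of
`K` that is UNRAMIFIED at every finite place ("trivial conductor") and has infinity type
`(ℓ₁, ℓ₂) = (−a, b)` in the critical cone `Σ⁺ = {ℓ₁ ≤ −1, ℓ₂ ≥ 1}` (tree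
`HasInfinityType (fun _ ↦ a) (fun _ ↦ −b)`, `a, b ≥ 1`; the central ray of `IsBDPLFunction` is
`a = b`), for every `p`-adic avatar `r` of `ψ` (`IsPAdicAvatarOf ι ψ r`) factoring through the pair
(`FactorsThroughPair κ₁ κ₂ r`), and for every ENTIRE `L` agreeing with the Euler product `L(f/K, ψ, s)`
(`rankinSelbergEulerProductHecke f ψ s`) on `re s > a + 2`, the value of `L₂` at
`(T₁, T₂) = (r(γ₁) − 1, r(γ₂) − 1)` is

  `ι⁻¹( Γ(b)Γ(b+1)/π^{2b+1} · 𝓔(f, ψ) · L(1) / Ω_K^{2(a+b)} ) · Ω_p^{2(a+b)}`,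

`𝓔(f, ψ) = toricEulerFactor p f 𝔭 𝔭' ψ = P(ψ(𝔭)) P(ψ(𝔭̄)⁻¹)`, `P(x) = 1 − a_p p⁻¹ x + ε_p x²` with
`ε_p` read off the level (`= (1 − p⁻¹ψ(𝔭)α)(1 − p⁻¹ψ(𝔭)β)(1 − ψ⁻¹(𝔭̄)α⁻¹)(1 − ψ⁻¹(𝔭̄)β⁻¹)` for `p ∤ N`,
`toricEulerFactor_eq_castellaWan`; scope flag `CW-211-level` of the module docstring for `p ∣ N`).
Parameters: the embedding datum `ι : ℚ̄_p ≃ ℂ`, the primes `𝔭` (meant: induced by `ι⁻¹`, the `𝔭` of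
`IsBDPLFunction`) and `𝔭' = 𝔭̄` of `K` above the split `p`, the pair `(κ₁, κ₂)` and `γ₁, γ₂ ∈ Γ_K`
(meant: an adapted generator pair, `ZpExtension.IsTopGeneratorPair κ₁ κ₂ γ₁ γ₂`), the form
`f ∈ S₂(Γ₀(N))` (meant: the newform of `E`, `N` its conductor), the CM periods `Ω_K ∈ ℂ`, `Ω_p ∈ ℂ_p`
(meant: `Ω_K ≠ 0`, `Ω_p ∈ R₀^×`, those of `IsBDPLFunction`). A PREDICATE — not a construction, not an
existence claim. On the central ray it prescribes EXACTLY the values of `IsBDPLFunction ι 𝔭 · · f ΩK Ωp`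
(`hasValueAt₂_centralRay`, `exists_hasValueAt₂_and_bdp`); two `L₂` satisfying it agree at every point
of the typed range (`hasValueAt₂_of_hasValueAt₂`) and are equal under the grid hypothesis of
`eq_of_infinite`. [cite: CastellaWan2023, §2.4 Thm. 2.11 with §2.1 (Σ⁺, Def. 2.1) and Thm. 2.7 (arXiv:1607.02019 store p0007–p0010)]
[cite: Castella2018, Thm. 3.1] [cite: CastellaHsieh2018, §3.3 (infinity types and avatars)] -/
def IsToricTwoVarLFunction (ι : PadicAlgCl p ≃+* ℂ) (𝔭 𝔭' : HeightOneSpectrum (𝓞 K))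
    (κ₁ κ₂ : ZpExtension K p) (γ₁ γ₂ : absoluteGaloisGroup K) (f : CuspForm (Gamma0 N) 2) (ΩK : ℂ)
    (Ωp : ℂ_[p]) (L₂ : PowerSeries (UnrSeries p)) : Prop :=
  ∀ (ψ : HeckeCharacter K) (a b : ℕ), 1 ≤ a → 1 ≤ b →
    ψ.HasInfinityType (fun _ ↦ (a : ℤ)) (fun _ ↦ -(b : ℤ)) →
    (∀ w : HeightOneSpectrum (𝓞 K), ψ.IsUnramifiedAt w) →
    ∀ r : FramedGaloisRep K (PadicAlgCl p) 1, IsPAdicAvatarOf ι ψ r → FactorsThroughPair κ₁ κ₂ r →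
    ∀ L : ℂ → ℂ, Differentiable ℂ L →
      (∀ s : ℂ, (a : ℝ) + 2 < s.re → L s = rankinSelbergEulerProductHecke f ψ s) →
      UnrSeries.HasValueAt₂ L₂ (avatarValueAt r γ₁ - 1) (avatarValueAt r γ₂ - 1)
        (((ι.symm (toricInterpolationValue p f 𝔭 𝔭' ψ a b ΩK (L 1)) : PadicAlgCl p) : ℂ_[p]) *
          Ωp ^ (2 * (a + b)))

/-! #### API -/

variable {ι : PadicAlgCl p ≃+* ℂ} {𝔭 𝔭' : HeightOneSpectrum (𝓞 K)} {κ₁ κ₂ : ZpExtension K p}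
  {γ₁ γ₂ : absoluteGaloisGroup K} {f : CuspForm (Gamma0 N) 2} {ΩK : ℂ} {Ωp : ℂ_[p]}
  {L₂ L₂' : PowerSeries (UnrSeries p)}

/-- Unfolding `IsToricTwoVarLFunction` at one character of the typed range: the prescribed value of
`L₂` at `(r(γ₁) − 1, r(γ₂) − 1)`. [cite: CastellaWan2023, §2.4 Thm. 2.11 (arXiv:1607.02019 store p0010)] -/
theorem IsToricTwoVarLFunction.hasValueAt₂
    (hL : IsToricTwoVarLFunction ι 𝔭 𝔭' κ₁ κ₂ γ₁ γ₂ f ΩK Ωp L₂)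
    {ψ : HeckeCharacter K} {a b : ℕ} (ha : 1 ≤ a) (hb : 1 ≤ b)
    (hinf : ψ.HasInfinityType (fun _ ↦ (a : ℤ)) (fun _ ↦ -(b : ℤ)))
    (hunr : ∀ w : HeightOneSpectrum (𝓞 K), ψ.IsUnramifiedAt w)
    {r : FramedGaloisRep K (PadicAlgCl p) 1} (hr : IsPAdicAvatarOf ι ψ r)
    (hκ : FactorsThroughPair κ₁ κ₂ r) {L : ℂ → ℂ} (hLd : Differentiable ℂ L)
    (hLe : ∀ s : ℂ, (a : ℝ) + 2 < s.re → L s = rankinSelbergEulerProductHecke f ψ s) :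
    UnrSeries.HasValueAt₂ L₂ (avatarValueAt r γ₁ - 1) (avatarValueAt r γ₂ - 1)
      (((ι.symm (toricInterpolationValue p f 𝔭 𝔭' ψ a b ΩK (L 1)) : PadicAlgCl p) : ℂ_[p]) *
        Ωp ^ (2 * (a + b))) :=
  hL ψ a b ha hb hinf hunr r hr hκ L hLd hLe

/-- The prescribed value at a character of the typed range is unique: any value `v` of `L₂` at
`(r(γ₁) − 1, r(γ₂) − 1)` is Castella–Wan's right-hand side. [cite: CastellaWan2023, §2.4 Thm. 2.11 (arXiv:1607.02019 store p0010)] -/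
theorem IsToricTwoVarLFunction.eq_of_hasValueAt₂
    (hL : IsToricTwoVarLFunction ι 𝔭 𝔭' κ₁ κ₂ γ₁ γ₂ f ΩK Ωp L₂)
    {ψ : HeckeCharacter K} {a b : ℕ} (ha : 1 ≤ a) (hb : 1 ≤ b)
    (hinf : ψ.HasInfinityType (fun _ ↦ (a : ℤ)) (fun _ ↦ -(b : ℤ)))
    (hunr : ∀ w : HeightOneSpectrum (𝓞 K), ψ.IsUnramifiedAt w)
    {r : FramedGaloisRep K (PadicAlgCl p) 1} (hr : IsPAdicAvatarOf ι ψ r)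
    (hκ : FactorsThroughPair κ₁ κ₂ r) {L : ℂ → ℂ} (hLd : Differentiable ℂ L)
    (hLe : ∀ s : ℂ, (a : ℝ) + 2 < s.re → L s = rankinSelbergEulerProductHecke f ψ s)
    {v : ℂ_[p]}
    (hv : UnrSeries.HasValueAt₂ L₂ (avatarValueAt r γ₁ - 1) (avatarValueAt r γ₂ - 1) v) :
    v = ((ι.symm (toricInterpolationValue p f 𝔭 𝔭' ψ a b ΩK (L 1)) : PadicAlgCl p) : ℂ_[p]) *
        Ωp ^ (2 * (a + b)) :=
  hv.unique (hL.hasValueAt₂ ha hb hinf hunr hr hκ hLd hLe)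

/-- **Two frames prescribe the same values**: if `L₂` and `L₂'` both satisfy the predicate (same
parameters) then every value of `L₂` at a point of the typed range is a value of `L₂'` there — the
pointwise content of uniqueness; with a grid of such points, `eq_of_infinite` upgrades it to `L₂ = L₂'`.
[cite: CastellaWan2023, §2.4 Thm. 2.11 and Cor. 2.12 (proof: "direct comparison of their interpolation properties") (arXiv:1607.02019 store p0010)] -/
theorem IsToricTwoVarLFunction.hasValueAt₂_of_hasValueAt₂
    (hL : IsToricTwoVarLFunction ι 𝔭 𝔭' κ₁ κ₂ γ₁ γ₂ f ΩK Ωp L₂)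
    (hL' : IsToricTwoVarLFunction ι 𝔭 𝔭' κ₁ κ₂ γ₁ γ₂ f ΩK Ωp L₂')
    {ψ : HeckeCharacter K} {a b : ℕ} (ha : 1 ≤ a) (hb : 1 ≤ b)
    (hinf : ψ.HasInfinityType (fun _ ↦ (a : ℤ)) (fun _ ↦ -(b : ℤ)))
    (hunr : ∀ w : HeightOneSpectrum (𝓞 K), ψ.IsUnramifiedAt w)
    {r : FramedGaloisRep K (PadicAlgCl p) 1} (hr : IsPAdicAvatarOf ι ψ r)
    (hκ : FactorsThroughPair κ₁ κ₂ r) {L : ℂ → ℂ} (hLd : Differentiable ℂ L)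
    (hLe : ∀ s : ℂ, (a : ℝ) + 2 < s.re → L s = rankinSelbergEulerProductHecke f ψ s)
    {v : ℂ_[p]}
    (hv : UnrSeries.HasValueAt₂ L₂ (avatarValueAt r γ₁ - 1) (avatarValueAt r γ₂ - 1) v) :
    UnrSeries.HasValueAt₂ L₂' (avatarValueAt r γ₁ - 1) (avatarValueAt r γ₂ - 1) v := by
  rw [hL.eq_of_hasValueAt₂ ha hb hinf hunr hr hκ hLd hLe hv]
  exact hL'.hasValueAt₂ ha hb hinf hunr hr hκ hLd hLe

/-- **Agreement with the one-variable BDP frame on the central ray.** For an everywhere unramified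
`ψ` of type `(−n, n)`, `n > 0` (tree `(n, −n)`) with `ψ(𝔭̄) = ψ(𝔭)⁻¹`, avatar `r` through the pair,
and an entire continuation `L` of `L(f/K, ψ, s)` from `re s > 3/2` (where the product converges for
such unitary `ψ`), the value the predicate prescribes at `(r(γ₁) − 1, r(γ₂) − 1)` is EXACTLY the
right-hand side of `IsBDPLFunction` at `(ψ, n)`:
`ι⁻¹(bdpInterpolationValue p f 𝔭 ψ n ΩK) · Ωp^{4n}` (`Γ(ℓ₂)Γ(ℓ₂+1) = Γ(n)Γ(n+1)`,
`π^{2ℓ₂+1} = π^{2n+1}`, `2(ℓ₂ − ℓ₁) = 4n`, `𝓔(f, ψ) = P(ψ(𝔭))²`, `L(1) = rankinSelbergValueHecke f ψ 1`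
by `rankinSelbergValueHecke_eq`). Castella–Wan Cor. 2.12 ("`L_{𝔭,ac}(f/K) = ℒ^BDP_𝔭(f/K)²` …
direct comparison of their interpolation properties"), value by value.
[cite: CastellaWan2023, Cor. 2.12 with Thm. 2.7 and Thm. 2.11 (arXiv:1607.02019 store p0009–p0010)] [cite: Castella2018, Thm. 3.1] -/
theorem IsToricTwoVarLFunction.hasValueAt₂_centralRay
    (hL : IsToricTwoVarLFunction ι 𝔭 𝔭' κ₁ κ₂ γ₁ γ₂ f ΩK Ωp L₂)
    {ψ : HeckeCharacter K} {n : ℕ} (hn : 0 < n)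
    (hinf : ψ.HasInfinityType (fun _ ↦ (n : ℤ)) (fun _ ↦ -(n : ℤ)))
    (hunr : ∀ w : HeightOneSpectrum (𝓞 K), ψ.IsUnramifiedAt w)
    (hψ : heckeValueExtZero ψ 𝔭' = (heckeValueExtZero ψ 𝔭)⁻¹)
    {r : FramedGaloisRep K (PadicAlgCl p) 1} (hr : IsPAdicAvatarOf ι ψ r)
    (hκ : FactorsThroughPair κ₁ κ₂ r) {L : ℂ → ℂ} (hLd : Differentiable ℂ L)
    (hLe : ∀ s : ℂ, 3 / 2 < s.re → L s = rankinSelbergEulerProductHecke f ψ s) :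
    UnrSeries.HasValueAt₂ L₂ (avatarValueAt r γ₁ - 1) (avatarValueAt r γ₂ - 1)
      (((ι.symm (bdpInterpolationValue p f 𝔭 ψ n ΩK) : PadicAlgCl p) : ℂ_[p]) * Ωp ^ (4 * n)) := by
  have hLe' : ∀ s : ℂ, (n : ℝ) + 2 < s.re → L s = rankinSelbergEulerProductHecke f ψ s :=
    fun s hs ↦ hLe s (by have : (0 : ℝ) ≤ n := Nat.cast_nonneg n; linarith)
  have h := hL.hasValueAt₂ hn hn hinf hunr hr hκ hLd hLe'
  rw [← rankinSelbergValueHecke_eq hLd hLe 1,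
    toricInterpolationValue_diag_eq_bdpInterpolationValue p f hψ n ΩK] at h
  convert h using 2
  ring

/-- **Pointwise comparison with a BDP frame.** If `L₂` is a toric frame and `L₁ ∈ R₀⟦T⟧` is a BDP
frame `IsBDPLFunction ι 𝔭 κ γ f ΩK Ωp L₁` (same `ι`, `𝔭`, `f`, periods; `κ`, `γ` the anticyclotomic
datum), then at every central-ray character `ψ` as in `hasValueAt₂_centralRay` whose avatar ALSO
factors through `κ`, the two frames have a COMMON value: `L₂(r(γ₁) − 1, r(γ₂) − 1) = L₁(r(γ) − 1)`
— "restriction to the anticyclotomic line is comparable with `IsBDPLFunction` frames pointwise"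
(«D1-CONE»). [cite: CastellaWan2023, Cor. 2.12 (arXiv:1607.02019 store p0010)] [cite: Castella2018, Thm. 3.1] -/
theorem IsToricTwoVarLFunction.exists_hasValueAt₂_and_bdp
    (hL : IsToricTwoVarLFunction ι 𝔭 𝔭' κ₁ κ₂ γ₁ γ₂ f ΩK Ωp L₂)
    {κ : ZpExtension K p} {γ : absoluteGaloisGroup K} {L₁ : UnrSeries p}
    (hL₁ : IsBDPLFunction ι 𝔭 κ γ f ΩK Ωp L₁)
    {ψ : HeckeCharacter K} {n : ℕ} (hn : 0 < n)
    (hinf : ψ.HasInfinityType (fun _ ↦ (n : ℤ)) (fun _ ↦ -(n : ℤ)))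
    (hunr : ∀ w : HeightOneSpectrum (𝓞 K), ψ.IsUnramifiedAt w)
    (hψ : heckeValueExtZero ψ 𝔭' = (heckeValueExtZero ψ 𝔭)⁻¹)
    {r : FramedGaloisRep K (PadicAlgCl p) 1} (hr : IsPAdicAvatarOf ι ψ r)
    (hκ : FactorsThroughPair κ₁ κ₂ r) (hκ' : FactorsThroughZp κ r)
    {L : ℂ → ℂ} (hLd : Differentiable ℂ L)
    (hLe : ∀ s : ℂ, 3 / 2 < s.re → L s = rankinSelbergEulerProductHecke f ψ s) :
    ∃ v : ℂ_[p], UnrSeries.HasValueAt₂ L₂ (avatarValueAt r γ₁ - 1) (avatarValueAt r γ₂ - 1) v ∧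
      L₁.HasValueAt (avatarValueAt r γ - 1) v :=
  ⟨_, hL.hasValueAt₂_centralRay hn hinf hunr hψ hr hκ hLd hLe, hL₁.hasValueAt hn hunr hinf hr hκ'⟩

/-- **UNIQUENESS.** Two `L₂, L₂' ∈ R₀⟦T₁⟧⟦T₂⟧` satisfying the predicate with the same parameters are
EQUAL as soon as the points of interpolation contain a GRID `D₁ × D₂` — two infinite subsets `D₁, D₂`
of a closed disc `‖·‖ ≤ ‖ϖ‖`, `0 < ‖ϖ‖ < 1`, such that every `(x, y) ∈ D₁ × D₂` is the point
`(r(γ₁) − 1, r(γ₂) − 1)` of SOME character of the typed range (an unramified `ψ` of type `(−a, b) ∈ Σ⁺`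
with avatar `r` through the pair, together with an entire continuation of its `L`-function): both
series then have Castella–Wan's value at every grid point, and the identity principle
(`UnrSeries.eq_of_infinite_hasValueAt₂_eq`, Gouvêa Cor. 5.6.4 fibrewise) concludes. This is the
"iterate one-variable density" of the request («D1-CONE», UNIQUENESS) in the exact form the identity
principle needs; for the `𝔭`- and `𝔭̄`-ramified pair the first coordinate of an interpolation point depends
on `a` alone and the second on `b` alone, and both accumulate at `0` along `a, b ∈ p^k ℕ`, so grids
exist granted a supply of interpolation characters — which is NOT constructed here.
[cite: CastellaWan2023, §2.4 Thm. 2.11 and Cor. 2.12 (proof) (arXiv:1607.02019 store p0010)] [cite: Gouvea1993PadicNumbers, §5.6 Cor. 5.6.4] -/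
theorem IsToricTwoVarLFunction.eq_of_infinite
    (hL : IsToricTwoVarLFunction ι 𝔭 𝔭' κ₁ κ₂ γ₁ γ₂ f ΩK Ωp L₂)
    (hL' : IsToricTwoVarLFunction ι 𝔭 𝔭' κ₁ κ₂ γ₁ γ₂ f ΩK Ωp L₂')
    {ϖ : ℂ_[p]} (hϖ0 : ϖ ≠ 0) (hϖ : ‖ϖ‖ < 1) {D₁ D₂ : Set ℂ_[p]}
    (hD₁ : D₁.Infinite) (hD₁ϖ : ∀ x ∈ D₁, ‖x‖ ≤ ‖ϖ‖)
    (hD₂ : D₂.Infinite) (hD₂ϖ : ∀ y ∈ D₂, ‖y‖ ≤ ‖ϖ‖)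
    (hgrid : ∀ x ∈ D₁, ∀ y ∈ D₂, ∃ (ψ : HeckeCharacter K) (a b : ℕ)
      (r : FramedGaloisRep K (PadicAlgCl p) 1) (L : ℂ → ℂ),
      1 ≤ a ∧ 1 ≤ b ∧ ψ.HasInfinityType (fun _ ↦ (a : ℤ)) (fun _ ↦ -(b : ℤ)) ∧
      (∀ w : HeightOneSpectrum (𝓞 K), ψ.IsUnramifiedAt w) ∧ IsPAdicAvatarOf ι ψ r ∧
      FactorsThroughPair κ₁ κ₂ r ∧ Differentiable ℂ L ∧
      (∀ s : ℂ, (a : ℝ) + 2 < s.re → L s = rankinSelbergEulerProductHecke f ψ s) ∧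
      avatarValueAt r γ₁ - 1 = x ∧ avatarValueAt r γ₂ - 1 = y) :
    L₂ = L₂' := by
  refine UnrSeries.eq_of_infinite_hasValueAt₂_eq hϖ0 hϖ hD₁ hD₁ϖ hD₂ hD₂ϖ fun x hx y hy ↦ ?_
  obtain ⟨ψ, a, b, r, L, ha, hb, hinf, hunr, hr, hκ, hLd, hLe, rfl, rfl⟩ := hgrid x hx y hy
  exact ⟨_, hL.hasValueAt₂ ha hb hinf hunr hr hκ hLd hLe,
    hL'.hasValueAt₂ ha hb hinf hunr hr hκ hLd hLe⟩

end Frame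

end Literature.NumberTheory.EllipticCurves

end
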